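import Mathlib
import HarnessLib
import Summits.ABC.ABC.Statement
import Summits.ABC.ABC.Theorems.SoloBlindPow2EndKnown
import Summits.ABC.ABC.Theorems.SoloBlindShapeAKnown
import Summits.ABC.ABC.Theorems.SoloBlindShapeCDKnown

/-!
# `ω(abc) = 3`: dispatching an abc triple with support `{2, p, q}` to its shape — the two leaves

`Summits/ABC/ABC/Theorems/SoloBlindOmega3Leaves.lean`; namespace `Summit.ABC.ABC.Theorems`
(solo seat `solo-ABC-blind`, wall coordinate C1⁗(1); assembles `SoloBlindShapeBKnown` (B),
`SoloBlindPow2EndKnown` (E, F), `SoloBlindShapeAKnown` (A), `SoloBlindShapeCDKnown` (C, D)).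

`a, b, c` pairwise coprime ⟹ each of `2, p, q` divides exactly one of them.  Two leaves cover all placements
up to `a ↔ b`, `p ↔ q` (the rest contradict `c ≥ 2`, `p ∤ 2`), each ending in the uniform bound
`log c ≤ 10¹³ · log p · log q · (1 + log log max(p, q)) + log 2`:

* `omega3_leaf_two_dvd_a` : `2 ∣ a`, `q ∣ c` — shapes C / A / E according to where `p` lies;
* `omega3_leaf_two_dvd_c` : `2 ∣ c`, `p ∣ a` — shapes F / B / D according to where `q` lies.

Exponents are extracted by `eq_prime_pow_pos` and `Nat.ordProj_mul_ordCompl_eq_self`; the shape constants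
(`50000 · log 2`, `10¹²`, `10¹³`, `log log p` vs `log log q`) are absorbed by `omega3_absorb`.
Trust base: the two named facts, as hypotheses; everything else is proved.  The statement for every triple
is `omega3_log_c_le` in `SoloBlindOmega3Known`.
-/

noncomputable section

namespace Summit.ABC.ABC.Theorems

open Real Literature.NumberTheory.Transcendental Literature.NumberTheory.DiophantineGeometry
  Literature.NumberTheory.DiophantineGeometry.Dioph

/-- Leaf of the `ω = 3` dispatcher: `2 ∣ a` and `q ∣ c` — shapes C (`p ∣ a`), A (`p ∣ b`), E (`p ∣ c`).
[folklore] -/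
theorem omega3_leaf_two_dvd_a (hBL : bugeaudLaurent1996_rat) (hM : matveev2000_linearFormsLog_rat)
    {p q a b c : ℕ} (hp : p.Prime) (hq : q.Prime) (hp2 : p ≠ 2) (hq2 : q ≠ 2) (hpq : p ≠ q)
    (habc : IsABCTriple a b c) (hS : (a * b * c).primeFactors = {2, p, q}) (h2a : 2 ∣ a)
    (hqc : q ∣ c) :
    Real.log c ≤
      10 ^ 13 * Real.log p * Real.log q * (1 + Real.log (Real.log (max (p : ℝ) q))) + Real.log 2 := by
  obtain ⟨ha, hb, heq, hcop⟩ := habc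
  have hc : 0 < c := by omega
  have hp3 : 3 ≤ p := by have := hp.two_le; omega
  have hq3 : 3 ≤ q := by have := hq.two_le; omega
  have hac : Nat.Coprime a c := by rw [← heq]; exact Nat.coprime_self_add_right.mpr hcop
  have hbc : Nat.Coprime b c := by rw [← heq]; exact Nat.coprime_add_self_right.mpr hcop.symm
  have hmem : ∀ d, d.Prime → d ∣ a * b * c → d = 2 ∨ d = p ∨ d = q := by
    intro d hd hdd
    have : d ∈ (a * b * c).primeFactors := Nat.mem_primeFactors.mpr ⟨hd, hdd, by positivity⟩
    rw [hS] at this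
    simpa using this
  have excl : ∀ {m n r : ℕ}, Nat.Coprime m n → r.Prime → r ∣ m → ¬ r ∣ n := by
    intro m n r hmn hr hrm hrn
    have := Nat.dvd_gcd hrm hrn
    rw [hmn.gcd_eq_one] at this
    exact hr.one_lt.ne' (Nat.dvd_one.mp this)
  have h2b : ¬ 2 ∣ b := excl hcop Nat.prime_two h2a
  have h2c : ¬ 2 ∣ c := excl hac Nat.prime_two h2a
  have hqa : ¬ q ∣ a := fun h => excl hac hq h hqc
  have hqb : ¬ q ∣ b := fun h => excl hbc hq h hqc
  have hpabc : p ∣ a * b * c := by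
    have : p ∈ (a * b * c).primeFactors := by rw [hS]; simp
    exact (Nat.mem_primeFactors.mp this).2.1
  have hP : 1 < Real.log p := one_lt_log_of_three_le hp3
  have hQ : 1 < Real.log q := one_lt_log_of_three_le hq3
  have hlog2 : 0 < Real.log 2 := Real.log_pos (by norm_num)
  have hlog2' : Real.log 2 < 0.6931471808 := Real.log_two_lt_d9
  have hLp := loglog_le_loglog_max_left (q := q) hp3
  have hLq := loglog_le_loglog_max_right (p := p) hq3
  have hMp := loglog_nonneg_of_three_le hp3
  have hMq := loglog_nonneg_of_three_le hq3
  have hcq_of : ¬ p ∣ c → ∃ n, 0 < n ∧ c = q ^ n := fun hpc =>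
    eq_prime_pow_pos hq hc.ne' hqc fun {d} hd hdc => by
      rcases hmem d hd (hdc.mul_left (a * b)) with rfl | rfl | rfl
      · exact absurd hdc h2c
      · exact absurd hdc hpc
      · rfl
  rcases (Nat.Prime.dvd_mul hp).mp hpabc with hpab | hpc
  · rcases (Nat.Prime.dvd_mul hp).mp hpab with hpa | hpb
    · -- shape C: a = 2^k p^m, b = 1, c = q^n
      have hpb : ¬ p ∣ b := excl hcop hp hpa
      have hpc : ¬ p ∣ c := excl hac hp hpa
      have hb1 : b = 1 := Nat.eq_one_iff_not_exists_prime_dvd.mpr fun d hd hdb => by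
        rcases hmem d hd ((hdb.mul_left a).mul_right c) with rfl | rfl | rfl
        · exact h2b hdb
        · exact hpb hdb
        · exact hqb hdb
      obtain ⟨n, hn, hcq⟩ := hcq_of hpc
      have haa : 2 ^ a.factorization 2 * (a / 2 ^ a.factorization 2) = a :=
        Nat.ordProj_mul_ordCompl_eq_self a 2
      have ha'0 : a / 2 ^ a.factorization 2 ≠ 0 := fun h0 => by rw [h0, mul_zero] at haa; omega
      have h2a' : ¬ 2 ∣ a / 2 ^ a.factorization 2 := Nat.not_dvd_ordCompl Nat.prime_two ha.ne'
      have ha'p : a / 2 ^ a.factorization 2 =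
          p ^ (a / 2 ^ a.factorization 2).primeFactorsList.length :=
        Nat.eq_prime_pow_of_unique_prime_dvd ha'0 fun {d} hd hda' => by
          have hda : d ∣ a := hda'.trans (Nat.div_dvd_of_dvd (Nat.ordProj_dvd a 2))
          rcases hmem d hd ((hda.mul_right b).mul_right c) with rfl | rfl | rfl
          · exact absurd hda' h2a'
          · rfl
          · exact absurd hda hqa
      have hEq : 2 ^ a.factorization 2 * p ^ (a / 2 ^ a.factorization 2).primeFactorsList.length + 1 =
          q ^ n := by
        have e1 : 2 ^ a.factorization 2 * p ^ (a / 2 ^ a.factorization 2).primeFactorsList.length = a := by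
          rw [← ha'p]; exact haa
        rw [e1, ← hcq]; omega
      have key := shapeC_log_c_le hM hp hq hp2 hq2 hn hEq
      have hcR : (c : ℝ) = (q : ℝ) ^ n := by exact_mod_cast hcq
      rw [hcR]
      exact omega3_absorb hP.le hQ.le hMp hLp le_rfl (by linarith)
    · -- shape A: a = 2^k, b = p^l, c = q^m
      have hpa : ¬ p ∣ a := fun h => excl hcop hp h hpb
      have hpc : ¬ p ∣ c := excl hbc hp hpb
      obtain ⟨k, hk, ha2⟩ : ∃ k, 0 < k ∧ a = 2 ^ k :=
        eq_prime_pow_pos Nat.prime_two ha.ne' h2a fun {d} hd hda => by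
          rcases hmem d hd ((hda.mul_right b).mul_right c) with rfl | rfl | rfl
          · rfl
          · exact absurd hda hpa
          · exact absurd hda hqa
      obtain ⟨l, hl, hbp⟩ : ∃ l, 0 < l ∧ b = p ^ l :=
        eq_prime_pow_pos hp hb.ne' hpb fun {d} hd hdb => by
          rcases hmem d hd ((hdb.mul_left a).mul_right c) with rfl | rfl | rfl
          · exact absurd hdb h2b
          · rfl
          · exact absurd hdb hqb
      obtain ⟨m, hm, hcq⟩ := hcq_of hpc
      have hEq : 2 ^ k + p ^ l = q ^ m := by
        rw [← ha2, ← hbp, ← hcq]; exact heq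
      have key := shapeA_log_c_le hBL hM hp hq hp2 hq2 hpq hk hl hm hEq
      have hcR : (c : ℝ) = (q : ℝ) ^ m := by exact_mod_cast hcq
      rw [hcR]
      exact omega3_absorb hP.le hQ.le hMq hLq (by norm_num) key
  · -- shape E: a = 2^k, b = 1, c = p^l q^m
    have hpa : ¬ p ∣ a := fun h => excl hac hp h hpc
    have hpb : ¬ p ∣ b := fun h => excl hbc hp h hpc
    have ha2 : a = 2 ^ a.primeFactorsList.length :=
      Nat.eq_prime_pow_of_unique_prime_dvd ha.ne' fun {d} hd hda => by
        rcases hmem d hd ((hda.mul_right b).mul_right c) with rfl | rfl | rfl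
        · rfl
        · exact absurd hda hpa
        · exact absurd hda hqa
    have hb1 : b = 1 := Nat.eq_one_iff_not_exists_prime_dvd.mpr fun d hd hdb => by
      rcases hmem d hd ((hdb.mul_left a).mul_right c) with rfl | rfl | rfl
      · exact h2b hdb
      · exact hpb hdb
      · exact hqb hdb
    have hcc : p ^ c.factorization p * (c / p ^ c.factorization p) = c :=
      Nat.ordProj_mul_ordCompl_eq_self c p
    have hc'0 : c / p ^ c.factorization p ≠ 0 := fun h0 => by rw [h0, mul_zero] at hcc; omega
    have hpc' : ¬ p ∣ c / p ^ c.factorization p := Nat.not_dvd_ordCompl hp hc.ne'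
    have hqc' : q ∣ c / p ^ c.factorization p := by
      have hcop' : Nat.Coprime q (p ^ c.factorization p) :=
        ((Nat.coprime_primes hq hp).mpr (Ne.symm hpq)).pow_right _
      exact hcop'.dvd_of_dvd_mul_left (by rw [hcc]; exact hqc)
    obtain ⟨m, hm, hc'q⟩ : ∃ m, 0 < m ∧ c / p ^ c.factorization p = q ^ m :=
      eq_prime_pow_pos hq hc'0 hqc' fun {d} hd hdc' => by
        have hdc : d ∣ c := hdc'.trans (Nat.div_dvd_of_dvd (Nat.ordProj_dvd c p))
        rcases hmem d hd (hdc.mul_left (a * b)) with rfl | rfl | rfl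
        · exact absurd hdc h2c
        · exact absurd hdc' hpc'
        · rfl
    have hcN : c = p ^ c.factorization p * q ^ m := by
      rw [← hc'q]; exact hcc.symm
    have hEq : 1 + 2 ^ a.primeFactorsList.length = p ^ c.factorization p * q ^ m := by
      rw [← hcN, ← ha2]; omega
    have hl : 0 < c.factorization p := hp.factorization_pos_of_dvd hc.ne' hpc
    have key := shapeE_log_c_le hBL hp hq hp2 hq2 hpq hl hm hEq
    have hcR : (c : ℝ) = (p : ℝ) ^ c.factorization p * (q : ℝ) ^ m := by
      exact_mod_cast hcN
    rw [hcR]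
    refine omega3_absorb hP.le hQ.le le_rfl (hMp.trans hLp) (K := 50000 * Real.log 2)
      (by linarith) ?_
    linarith

/-- Leaf of the `ω = 3` dispatcher: `2 ∣ c` and `p ∣ a` — shapes F (`q ∣ a`), B (`q ∣ b`), D (`q ∣ c`).
[folklore] -/
theorem omega3_leaf_two_dvd_c (hBL : bugeaudLaurent1996_rat) (hM : matveev2000_linearFormsLog_rat)
    {p q a b c : ℕ} (hp : p.Prime) (hq : q.Prime) (hp2 : p ≠ 2) (hq2 : q ≠ 2) (hpq : p ≠ q)
    (habc : IsABCTriple a b c) (hS : (a * b * c).primeFactors = {2, p, q}) (h2c : 2 ∣ c)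
    (hpa : p ∣ a) :
    Real.log c ≤
      10 ^ 13 * Real.log p * Real.log q * (1 + Real.log (Real.log (max (p : ℝ) q))) + Real.log 2 := by
  obtain ⟨ha, hb, heq, hcop⟩ := habc
  have hc : 0 < c := by omega
  have hp3 : 3 ≤ p := by have := hp.two_le; omega
  have hq3 : 3 ≤ q := by have := hq.two_le; omega
  have hac : Nat.Coprime a c := by rw [← heq]; exact Nat.coprime_self_add_right.mpr hcop
  have hbc : Nat.Coprime b c := by rw [← heq]; exact Nat.coprime_add_self_right.mpr hcop.symm
  have hmem : ∀ d, d.Prime → d ∣ a * b * c → d = 2 ∨ d = p ∨ d = q := by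
    intro d hd hdd
    have : d ∈ (a * b * c).primeFactors := Nat.mem_primeFactors.mpr ⟨hd, hdd, by positivity⟩
    rw [hS] at this
    simpa using this
  have excl : ∀ {m n r : ℕ}, Nat.Coprime m n → r.Prime → r ∣ m → ¬ r ∣ n := by
    intro m n r hmn hr hrm hrn
    have := Nat.dvd_gcd hrm hrn
    rw [hmn.gcd_eq_one] at this
    exact hr.one_lt.ne' (Nat.dvd_one.mp this)
  have h2a : ¬ 2 ∣ a := fun h => excl hac Nat.prime_two h h2c
  have h2b : ¬ 2 ∣ b := fun h => excl hbc Nat.prime_two h h2c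
  have hpb : ¬ p ∣ b := excl hcop hp hpa
  have hpc : ¬ p ∣ c := excl hac hp hpa
  have hqabc : q ∣ a * b * c := by
    have : q ∈ (a * b * c).primeFactors := by rw [hS]; simp
    exact (Nat.mem_primeFactors.mp this).2.1
  have hP : 1 < Real.log p := one_lt_log_of_three_le hp3
  have hQ : 1 < Real.log q := one_lt_log_of_three_le hq3
  have hlog2 : 0 < Real.log 2 := Real.log_pos (by norm_num)
  have hlog2' : Real.log 2 < 0.6931471808 := Real.log_two_lt_d9
  have hLp := loglog_le_loglog_max_left (q := q) hp3
  have hLq := loglog_le_loglog_max_right (p := p) hq3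
  have hMp := loglog_nonneg_of_three_le hp3
  have hMq := loglog_nonneg_of_three_le hq3
  have hc2_of : ¬ q ∣ c → c = 2 ^ c.primeFactorsList.length := fun hqc =>
    Nat.eq_prime_pow_of_unique_prime_dvd hc.ne' fun {d} hd hdc => by
      rcases hmem d hd (hdc.mul_left (a * b)) with rfl | rfl | rfl
      · rfl
      · exact absurd hdc hpc
      · exact absurd hdc hqc
  have hb1_of : ¬ q ∣ b → b = 1 := fun hqb =>
    Nat.eq_one_iff_not_exists_prime_dvd.mpr fun d hd hdb => by
      rcases hmem d hd ((hdb.mul_left a).mul_right c) with rfl | rfl | rfl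
      · exact h2b hdb
      · exact hpb hdb
      · exact hqb hdb
  rcases (Nat.Prime.dvd_mul hq).mp hqabc with hqab | hqc
  · rcases (Nat.Prime.dvd_mul hq).mp hqab with hqa | hqb
    · -- shape F: a = p^l q^m, b = 1, c = 2^k
      have hqb : ¬ q ∣ b := excl hcop hq hqa
      have hqc : ¬ q ∣ c := excl hac hq hqa
      have hb1 := hb1_of hqb
      have hc2 := hc2_of hqc
      have haa : p ^ a.factorization p * (a / p ^ a.factorization p) = a :=
        Nat.ordProj_mul_ordCompl_eq_self a p
      have ha'0 : a / p ^ a.factorization p ≠ 0 := fun h0 => by rw [h0, mul_zero] at haa; omega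
      have hpa' : ¬ p ∣ a / p ^ a.factorization p := Nat.not_dvd_ordCompl hp ha.ne'
      have hqa' : q ∣ a / p ^ a.factorization p := by
        have hcop' : Nat.Coprime q (p ^ a.factorization p) :=
          ((Nat.coprime_primes hq hp).mpr (Ne.symm hpq)).pow_right _
        exact hcop'.dvd_of_dvd_mul_left (by rw [haa]; exact hqa)
      obtain ⟨m, hm, ha'q⟩ : ∃ m, 0 < m ∧ a / p ^ a.factorization p = q ^ m :=
        eq_prime_pow_pos hq ha'0 hqa' fun {d} hd hda' => by
          have hda : d ∣ a := hda'.trans (Nat.div_dvd_of_dvd (Nat.ordProj_dvd a p))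
          rcases hmem d hd ((hda.mul_right b).mul_right c) with rfl | rfl | rfl
          · exact absurd hda h2a
          · exact absurd hda' hpa'
          · rfl
      have haN : a = p ^ a.factorization p * q ^ m := by
        rw [← ha'q]; exact haa.symm
      have hEq : 1 + p ^ a.factorization p * q ^ m = 2 ^ c.primeFactorsList.length := by
        rw [← haN, ← hc2]; omega
      have hl : 0 < a.factorization p := hp.factorization_pos_of_dvd ha.ne' hpa
      have key := shapeF_log_c_le hBL hp hq hp2 hq2 hpq hl hm hEq
      have hcR : (c : ℝ) = (2 : ℝ) ^ c.primeFactorsList.length := by exact_mod_cast hc2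
      rw [hcR]
      refine omega3_absorb hP.le hQ.le le_rfl (hMp.trans hLp) (K := 50000 * Real.log 2)
        (by linarith) ?_
      linarith
    · -- shape B: a = p^l, b = q^m, c = 2^n
      have hqa : ¬ q ∣ a := fun h => excl hcop hq h hqb
      have hqc : ¬ q ∣ c := excl hbc hq hqb
      have hc2 := hc2_of hqc
      obtain ⟨l, hl, hap⟩ : ∃ l, 0 < l ∧ a = p ^ l :=
        eq_prime_pow_pos hp ha.ne' hpa fun {d} hd hda => by
          rcases hmem d hd ((hda.mul_right b).mul_right c) with rfl | rfl | rfl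
          · exact absurd hda h2a
          · rfl
          · exact absurd hda hqa
      obtain ⟨m, hm, hbq⟩ : ∃ m, 0 < m ∧ b = q ^ m :=
        eq_prime_pow_pos hq hb.ne' hqb fun {d} hd hdb => by
          rcases hmem d hd ((hdb.mul_left a).mul_right c) with rfl | rfl | rfl
          · exact absurd hdb h2b
          · exact absurd hdb hpb
          · rfl
      have hEq : p ^ l + q ^ m = 2 ^ c.primeFactorsList.length := by
        rw [← hap, ← hbq, ← hc2]; exact heq
      have key := shapeB_log_c_le hBL hp hq hp2 hq2 hpq hl hm hEq
      have hcR : (c : ℝ) = (2 : ℝ) ^ c.primeFactorsList.length := by exact_mod_cast hc2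
      rw [hcR]
      refine omega3_absorb hP.le hQ.le le_rfl (hMp.trans hLp) (K := 50000 * Real.log 2)
        (by linarith) ?_
      linarith
  · -- shape D: a = p^m, b = 1, c = 2^k q^n
    have hqa : ¬ q ∣ a := fun h => excl hac hq h hqc
    have hqb : ¬ q ∣ b := fun h => excl hbc hq h hqc
    have hb1 := hb1_of hqb
    obtain ⟨m, hm, hap⟩ : ∃ m, 0 < m ∧ a = p ^ m :=
      eq_prime_pow_pos hp ha.ne' hpa fun {d} hd hda => by
        rcases hmem d hd ((hda.mul_right b).mul_right c) with rfl | rfl | rfl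
        · exact absurd hda h2a
        · rfl
        · exact absurd hda hqa
    have hcc : 2 ^ c.factorization 2 * (c / 2 ^ c.factorization 2) = c :=
      Nat.ordProj_mul_ordCompl_eq_self c 2
    have hc'0 : c / 2 ^ c.factorization 2 ≠ 0 := fun h0 => by rw [h0, mul_zero] at hcc; omega
    have h2c' : ¬ 2 ∣ c / 2 ^ c.factorization 2 := Nat.not_dvd_ordCompl Nat.prime_two hc.ne'
    have hc'q : c / 2 ^ c.factorization 2 = q ^ (c / 2 ^ c.factorization 2).primeFactorsList.length :=
      Nat.eq_prime_pow_of_unique_prime_dvd hc'0 fun {d} hd hdc' => by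
        have hdc : d ∣ c := hdc'.trans (Nat.div_dvd_of_dvd (Nat.ordProj_dvd c 2))
        rcases hmem d hd (hdc.mul_left (a * b)) with rfl | rfl | rfl
        · exact absurd hdc' h2c'
        · exact absurd hdc hpc
        · rfl
    have hcN : c = 2 ^ c.factorization 2 * q ^ (c / 2 ^ c.factorization 2).primeFactorsList.length := by
      rw [← hc'q]; exact hcc.symm
    have hEq : p ^ m + 1 = 2 ^ c.factorization 2 * q ^ (c / 2 ^ c.factorization 2).primeFactorsList.length := by
      rw [← hcN, ← hap]; omega
    have key := shapeD_log_c_le hM hp hq hp2 hq2 hm hEq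
    have hcR : (c : ℝ) =
        (2 : ℝ) ^ c.factorization 2 * (q : ℝ) ^ (c / 2 ^ c.factorization 2).primeFactorsList.length := by
      exact_mod_cast hcN
    rw [hcR]
    exact omega3_absorb hP.le hQ.le hMq hLq le_rfl key

end Summit.ABC.ABC.Theorems

end
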